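import Literature.Probability.RandomPlanarGeometry.SAWFiniteMemoryZ3
import HarnessLib

/-!
# A KERNEL-checkable certificate format for the Pönitz–Tittmann finite-memory bound on `μ(ℤ³)`

Topic `Literature/Probability/RandomPlanarGeometry` (the `ℤ³` twin of `SAWFiniteMemoryKernelTrie.lean`).
`SAWFiniteMemoryZ3.lean` bounds `μ(ℤ³)` by the Perron root of the memory-`K` automaton `FiniteMemory3.ptStep K`
through a Collatz–Wielandt certificate searched and checked inside one `native_decide`
(`FiniteMemory3.check`; tier CHECKED-native: `μ(ℤ³) ≤ 4.76`, `k = 10`). Here the certificate is a 6-ary TRIE of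
integer weights keyed by the step word (letters `Fin 3 × Bool`), produced offline and pasted as a literal in the
data files, and the verifier is a structural traversal that the KERNEL evaluates (`decide +kernel`, axioms
`propext`/`Classical.choice`/`Quot.sound` only):

* `WTrie3`, `WTrie3.find` — the trie and its lookup (`O(|s|)`);
* `verifyStateT3`, `verifyNodes3`, `verifyT3 K N D t` — positive root weight `≤ 2⁴¹` and, at every node of
  positive weight, positive successor weights and `D · Σ_a v(δ(s,a)) ≤ N · v(s)`;
* `certificate_of_verifyT3` — a `WordAutomaton.Certificate (ptStep K)` on the words of positive weight;
  `count_mul_pow_le_of_verifyT3`; **`connectiveConstant_three_le_of_verifyT3`** — `μ(ℤ³) ≤ N/D`.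

Instances (kernel tier, data files): `K = 6` (`715` states, Pönitz–Tittmann Table 2: `4.8075`), `K = 8`
(`9505` states, `4.7780`).

## References

* [PonitzTittmann2000] A. Pönitz, P. Tittmann, *Improved upper bounds for self-avoiding walks in ℤᵈ*,
  Electron. J. Combin. 7 (2000) R21, §2–3 and Table 2 (`d = 3`).
-/

open Finset Filter Topology Literature.Probability.LatticeModels
open scoped BigOperators

namespace Literature.Probability.RandomPlanarGeometry.SAW.Zd

namespace FiniteMemory3

/-! ### The trie -/

/-- A 6-ary trie of natural-number weights keyed by step words of `ℤ³` (letters `Fin 3 × Bool`): `node w c₀₊ c₀₋ c₁₊ c₁₋ c₂₊ c₂₋`.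
[cite: PonitzTittmann2000, §3 (the eigenvector, tabulated by state)] -/
inductive WTrie3 : Type
  | nil : WTrie3
  | node : ℕ → WTrie3 → WTrie3 → WTrie3 → WTrie3 → WTrie3 → WTrie3 → WTrie3

namespace WTrie3

/-- The sub-trie for the letter `a = (i, b)` (order `+e₀, -e₀, +e₁, -e₁, +e₂, -e₂`). [folklore] -/
def child (c₀ c₁ c₂ c₃ c₄ c₅ : WTrie3) (a : Fin 3 × Bool) : WTrie3 :=
  if a.1 = 0 then (if a.2 then c₀ else c₁)
  else if a.1 = 1 then (if a.2 then c₂ else c₃)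
  else (if a.2 then c₄ else c₅)

/-- Lookup of the weight of a word (`0` if absent). [cite: PonitzTittmann2000, §3] -/
def find : WTrie3 → List (Fin 3 × Bool) → ℕ
  | nil, _ => 0
  | node w _ _ _ _ _ _, [] => w
  | node _ c₀ c₁ c₂ c₃ c₄ c₅, a :: s => find (child c₀ c₁ c₂ c₃ c₄ c₅ a) s

/-- `find` on a `node` at a non-empty word descends to the child. [folklore] -/
private theorem find_node_cons (w : ℕ) (c₀ c₁ c₂ c₃ c₄ c₅ : WTrie3) (a : Fin 3 × Bool) (s : List (Fin 3 × Bool)) :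
    find (node w c₀ c₁ c₂ c₃ c₄ c₅) (a :: s) = find (child c₀ c₁ c₂ c₃ c₄ c₅ a) s := rfl

end WTrie3

/-! ### The verifier -/

/-- Check of one state `s` against the weight trie `t`: positive weight, successors of positive weight, Collatz–Wielandt
inequality over the six letters. [cite: PonitzTittmann2000, §3] -/
def verifyStateT3 (K N D : ℕ) (t : WTrie3) (s : List (Fin 3 × Bool)) : Bool :=
  decide (1 ≤ t.find s) &&
    letters.all (fun a =>
      match ptStep K s a with
      | none => true
      | some b => decide (1 ≤ t.find b)) &&
    decide (D * (letters.map fun a => ((ptStep K s a).map t.find).getD 0).sum ≤ N * t.find s)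

/-- Structural traversal of the trie: every node of positive weight, at the word `pre.reverse`, passes `verifyStateT3`
against the whole trie `root`. [cite: PonitzTittmann2000, §3] -/
def verifyNodes3 (K N D : ℕ) (root : WTrie3) : WTrie3 → List (Fin 3 × Bool) → Bool
  | WTrie3.nil, _ => true
  | WTrie3.node w c₀ c₁ c₂ c₃ c₄ c₅, pre =>
    (decide (w = 0) || verifyStateT3 K N D root pre.reverse) &&
      verifyNodes3 K N D root c₀ (((0 : Fin 3), true) :: pre) && verifyNodes3 K N D root c₁ (((0 : Fin 3), false) :: pre) &&
      verifyNodes3 K N D root c₂ (((1 : Fin 3), true) :: pre) && verifyNodes3 K N D root c₃ (((1 : Fin 3), false) :: pre) &&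
      verifyNodes3 K N D root c₄ (((2 : Fin 3), true) :: pre) && verifyNodes3 K N D root c₅ (((2 : Fin 3), false) :: pre)

/-- Soundness of the traversal: a word `pre.reverse ++ s` of positive weight in the sub-trie `t` passes the state check.
[folklore] -/
private theorem verifyStateT3_of_verifyNodes3 {K N D : ℕ} {root : WTrie3} :
    ∀ (t : WTrie3) (pre s : List (Fin 3 × Bool)), verifyNodes3 K N D root t pre = true → 1 ≤ t.find s →
      verifyStateT3 K N D root (pre.reverse ++ s) = true
  | WTrie3.nil, pre, s, _, h => by simp [WTrie3.find] at h
  | WTrie3.node w c₀ c₁ c₂ c₃ c₄ c₅, pre, [], hc, h => by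
    simp only [verifyNodes3, Bool.and_eq_true, Bool.or_eq_true, decide_eq_true_eq] at hc
    simp only [WTrie3.find] at h
    rcases hc.1.1.1.1.1.1 with h0 | hv
    · omega
    · simpa using hv
  | WTrie3.node w c₀ c₁ c₂ c₃ c₄ c₅, pre, a :: s, hc, h => by
    simp only [verifyNodes3, Bool.and_eq_true] at hc
    obtain ⟨⟨⟨⟨⟨⟨-, h0⟩, h1⟩, h2⟩, h3⟩, h4⟩, h5⟩ := hc
    rw [WTrie3.find_node_cons] at h
    have key : ∀ (c : WTrie3), verifyNodes3 K N D root c (a :: pre) = true →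
        WTrie3.find c s = WTrie3.find (WTrie3.child c₀ c₁ c₂ c₃ c₄ c₅ a) s →
        verifyStateT3 K N D root (pre.reverse ++ a :: s) = true := by
      intro c hcov he
      have := verifyStateT3_of_verifyNodes3 c (a :: pre) s hcov (by rw [he]; exact h)
      simpa using this
    obtain ⟨i, b⟩ := a
    fin_cases i <;> cases b
    · exact key c₁ h1 rfl
    · exact key c₀ h0 rfl
    · exact key c₃ h3 rfl
    · exact key c₂ h2 rfl
    · exact key c₅ h5 rfl
    · exact key c₄ h4 rfl

/-- **The trie certificate check** for `ℤ³`: root weight in `[1, 2⁴¹]` and every node of positive weight passes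
`verifyStateT3`. Evaluated by `decide +kernel` in the data files. [cite: PonitzTittmann2000, §3] -/
def verifyT3 (K N D : ℕ) (t : WTrie3) : Bool :=
  decide (1 ≤ t.find []) && decide (t.find [] ≤ 2 ^ 41) && verifyNodes3 K N D t t []

/-- **Soundness of `verifyT3`**: a Collatz–Wielandt certificate for `ptStep K` on the words of positive weight, root
weight `≤ 2⁴¹`. [cite: PonitzTittmann2000, §3] -/
theorem certificate_of_verifyT3 {K N D : ℕ} {t : WTrie3} (h : verifyT3 K N D t = true) :
    WordAutomaton.Certificate (ptStep K) {s | 1 ≤ t.find s} t.find N D ∧ t.find [] ≤ 2 ^ 41 := by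
  simp only [verifyT3, Bool.and_eq_true, decide_eq_true_eq] at h
  obtain ⟨⟨h0, hroot⟩, hnodes⟩ := h
  have key : ∀ s : List (Fin 3 × Bool), 1 ≤ t.find s →
      (∀ a b, ptStep K s a = some b → 1 ≤ t.find b) ∧
      D * ∑ a : Fin 3 × Bool, ((ptStep K s a).map t.find).getD 0 ≤ N * t.find s := by
    intro s hs
    have hst : verifyStateT3 K N D t s = true := by
      have := verifyStateT3_of_verifyNodes3 t [] s hnodes hs
      simpa using this
    simp only [verifyStateT3, Bool.and_eq_true, decide_eq_true_eq, List.all_eq_true] at hst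
    obtain ⟨⟨-, hsucc⟩, hcw⟩ := hst
    refine ⟨fun a b hb => ?_, ?_⟩
    · have := hsucc a (mem_letters a)
      rw [hb] at this
      simpa using this
    · rw [← sum_letters_map]
      exact hcw
  refine ⟨⟨h0, ?_, ?_, ?_⟩, hroot⟩
  · intro s hs a b hb
    exact (key s hs).1 a b hb
  · intro s hs
    exact hs
  · intro s hs
    exact (key s hs).2

/-- `cₙ(ℤ³) · Dⁿ ≤ Nⁿ · 2⁴¹` from a successful trie certificate check. [cite: PonitzTittmann2000, §3] -/
theorem count_mul_pow_le_of_verifyT3 {K N D : ℕ} {t : WTrie3} (h : verifyT3 K N D t = true) (n : ℕ) :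
    count 3 n * D ^ n ≤ N ^ n * 2 ^ 41 := by
  obtain ⟨hc, hroot⟩ := certificate_of_verifyT3 h
  exact le_trans (WordAutomaton.count_mul_pow_le hc (run_ne_none_of_isSAW K) n)
    (Nat.mul_le_mul_left _ hroot)

/-- **`μ(ℤ³) ≤ N/D` from a successful trie certificate check (kernel).** [cite: PonitzTittmann2000, §3 and Table 2 (d = 3)] -/
theorem connectiveConstant_three_le_of_verifyT3 {K N D : ℕ} {t : WTrie3} (h : verifyT3 K N D t = true) (hD : 0 < D) :
    connectiveConstant 3 ≤ (N : ℝ) / D := by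
  refine connectiveConstant_le_of_count_le (d := 3) (C := (2 : ℝ) ^ 41) (by positivity) (by positivity) fun n _ => ?_
  have h1 := count_mul_pow_le_of_verifyT3 h n
  have h2 : (count 3 n : ℝ) * (D : ℝ) ^ n ≤ (N : ℝ) ^ n * 2 ^ 41 := by exact_mod_cast h1
  have hDn : (0 : ℝ) < (D : ℝ) ^ n := by positivity
  rw [div_pow, mul_div_assoc', le_div_iff₀ hDn]
  linarith

end FiniteMemory3

end Literature.Probability.RandomPlanarGeometry.SAW.Zd
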